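import Summits.QuantumFields.BalabanUV.T4Continuum.Support.VariationalVectorTower
import Summits.QuantumFields.BalabanUV.T4Continuum.Support.VariationalVectorAverage

/-!
# T⁴ programme, spine node NE2 (U1a), lane P2 — THE VECTOR END OF ROAD P2 MODULO THE LEAVES, on the line-indexed carriers `QvL`:
# `vector_pair_bracket_sqrt` per level `n = L^k` + geometric decay of the three small leaf parameters ⟹ `towerLimitRate_effV_of_pairs`
# (`t4/skeletons/NE2-t4-ne2-p2.md` v0.15 §2.E row «⟹ V-END»; the `towerLimitRate_of_closedBrackets` PATTERN of the scalar END with the leaf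
# constants ABSTRACT; model level; cell `pub-balaban`)

NE2 formalisation swarm `b2b-balaban-t4-ne2-formalise-*`, leaf prover 10 GEN 3 (`prover-b2b-balaban-t4-ne2-formalise-leaf-10-g3-0`, lineage V-COMP TOWER);
journal INTENT CLAIMS.log 2026-08-20 13:41Z.  On top of `VariationalVectorTower.towerLimitRate_effV_of_pairs` (p218948: the η-rate currency on the `QvL`
carriers from per-level BRACKETS), the road's `VariationalVectorForm.vector_pair_bracket_sqrt` (p216339: the brackets from the five displayed vector LEAVES)
and `VariationalVectorAverage.continuous_QvL` (p218350) — BY NAME; two small real-function definitions (`eV`, `ePV`), nothing else defined.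

THE POINT (binder census of V-END in kernel form).  `vector_pair_bracket_sqrt` turns, at ONE level, the displayed leaf families V-UB (`Λ`), V-P (`C_P`),
V-FED (`δ`), V-ONE (`ε₁`, `δ′`, functional `ρ`), V-REG (`C_R`) into the two one-sided brackets with defects
`e = 2δ√(Λ·C_P(Λ+1)) + δ²·C_P(Λ+1)` and `e′ = ε₁C_R(Λ+1) + 2δ′√((Λ + ε₁C_R(Λ+1))·C_P(Λ+1)) + δ′²·C_P(Λ+1)`; `towerLimitRate_effV_of_pairs` turns
GEOMETRIC brackets along `n_k = L^k` into the rate.  In between sits only real arithmetic: `e`, `e′` are MONOTONE in every argument and LINEAR-OR-BETTER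
in the small parameters, so level constants `Λ_k ≤ Λ⋆`, `C_P,k ≤ C_P⋆`, `C_R,k ≤ C_R⋆` (k-UNIFORM) and `δ_k ≤ c_δ·θ^k`, `ε₁,k ≤ c_ε·θ^k`, `δ′_k ≤ c_δ′·θ^k`
(DECAY, `0 ≤ θ < 1`) give `e_k, e′_k ≤ C·θ^k` with `C = eV Λ⋆ C_P⋆ c_δ + ePV Λ⋆ C_P⋆ C_R⋆ c_ε c_δ′`.  Under the scalar road's CLASS the three small
parameters are `√d·c_m∕n`, `(d∕4+½)·L∕n²`, `√(2d(1+d²))·L·c₁∕n` — all `≤ c·(L⁻¹)^k` — so `θ = L⁻¹` as in `VariationalCovariantEnd`.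
 * §1 `eV`, `ePV` (LITERALLY the coefficients of `vector_pair_bracket_sqrt`'s conclusion), `eV_nonneg` ∕ `ePV_nonneg`, `eV_mono` ∕ `ePV_mono`,
   `eV_scale` ∕ `ePV_scale` (`t ∈ [0,1]`: `e(c·t) ≤ e(c)·t`), `eV_level_le` ∕ `ePV_level_le` (uniform bounds + decay ⟹ `≤ C·θ^k`);
 * §2 the (GF0) ∕ continuity binders of the bracket DERIVED from the tower's matrix form `G = qform Gm ∘ unc` (`Gm` PSD) and, one step up, from the COMP
   identity `G_{k+1} = Gtr G′_k` (`Gtr_transport`): `continuous_unc`, `continuous_qform`, `nonneg_of_qform`, `continuous_of_qform`, `eq_of_Gtr`,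
   `nonneg_of_Gtr`, `continuous_of_Gtr` — so no (GF0) ∕ continuity binder and no `Qk`-surjectivity binder (`QvL_surjective_of_ub`) survives in the END;
 * §3 **`vector_pair_brackets_of_leaves`** (one level, any finite-dimensional `E`: the five leaf families in `vector_pair_bracket_sqrt`'s letters at
   `Qk := QvL n M T`, `Q₁ := QvL L (fine n M) T′` ⟹ the two brackets with `(eV, ePV)`), and **`towerLimitRate_effV_of_leaves`** — THE VECTOR END OF ROAD
   P2 MODULO THE LEAVES: along `n_k = L^k`, binders = the COMP DATA identities (`hTcomp` ∕ `hRtr` ∕ `hGtr`, p218948's letters), `Gm k` PSD with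
   `G k = qform (Gm k) ∘ unc`, `Q₁`-surjectivity per level (the one-step V-UB-L of `VectorLineTransportUpperBound.exists_ubV_line`'s shape), the per-level
   displayed leaf families VERBATIM from p216339 with level constants bounded uniformly and the three small parameters decaying geometrically ⟹
   `TowerLimitRate (fun _ ↦ 1) 1 (k ↦ effV (L^k) M (R k) (Gm k) (QmL (L^k) M (T k)) a) (eV Λ⋆ C_P⋆ c_δ + ePV Λ⋆ C_P⋆ C_R⋆ c_ε c_δ′) θ`.
SOCKETS BY NAME (who discharges what): `hUBc`∕`hUBf`∕`hsurj₁` ← V-UB-L (`VectorLineTransportUpperBound`, leaf-03-g4 p218278); `hPc`∕`hPf` ← (Går)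
(`VariationalVectorGarding`, leaf-09-g6) + core (i) (`VariationalVectorPoincare` leaf-01-g5 p218347, `…PoincareNear` p219305) + `coerciveV_transport` (p218948);
`hFED` ← V-FED (`VariationalVectorFederbushPhys` p217269 ∕ `…LinePhys` p218349, leaf-01); `hONE` ← V-ONE-1F (`VariationalVectorOneStepPhys.blockSpin_Q1_le`
p219670, leaf-01-g6: the curl half at the frame-adapted one-step carriers `T′ k := frameT …`, which the tower may CHOOSE — only `T (k+1) = compL (T k) (T′ k)`
is forced; the `G′`-half modulo (GF2′)); `hREG` ← V-REG (no holder); the choice of `G` (V-GF) is open (NOTE N-ne2leaf01g6-1).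
WHAT IS NOT HERE: no leaf is discharged; the constants are abstract; the CLASS-to-decay arithmetic for concrete suppliers is theirs (pattern:
`VariationalCovariantEnd.level_defects_le`).

HONEST FRAMING (T4-DAG p. 1).  Model level; transports ∕ forms ∕ functionals DATA (no identification with Bałaban's `U(Γ)`, `Q̄`, minimisers — c5); [folklore]
plumbing + real arithmetic over tree theorems imported BY NAME; nothing printed is a hypothesis; data defs `eV`, `ePV` only, no `def … : Prop`, no `sorry`;
axioms standard.  V-END NOT proved (every leaf displayed); NE2 NOT proved; spine PROVED 0∕9 unchanged; rung (B)+1 finite T⁴ — NOT infinite volume, NOT mass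
gap, NOT Clay.  HONEST DEPENDENCY (cell, verbatim): continuum YM on T⁴ ⇐ BetaPertH ∧ nine spine estimates (0/9 proved); BetaPertH ⇐ (D1) ∧ (D4) ∧ CAP+tail;
G-an2-4 gates asym, D1 and NE2/3/4.
-/

noncomputable section

namespace Summit.QuantumFields.BalabanUV.T4Continuum.VariationalVectorEndOfLeaves

open Finset
open scoped Matrix ComplexConjugate ComplexOrder Matrix.Norms.L2Operator BigOperators
open Literature.MathematicalPhysics.QuantumFieldTheory.Balaban1983to89.B5Prop11Plancherel (Tor fine unitVec)
open Literature.MathematicalPhysics.QuantumFieldTheory.Balaban1983to89.B5Composition116 (sites)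
open Literature.Analysis.Complex (qform qform_nonneg_of_posSemidef)
open Summit.QuantumFields.BalabanUV.T4Continuum.VariationalTransfer (blockSpin)
open Summit.QuantumFields.BalabanUV.T4Continuum.VariationalColourTower (Rtrv)
open Summit.QuantumFields.BalabanUV.T4Continuum.CovariantAveragingTower (TowerLimitRate)
open Summit.QuantumFields.BalabanUV.T4Continuum.VectorBlockTrialForm (nsqV nsqV_nonneg QvL compL)
open Summit.QuantumFields.BalabanUV.T4Continuum.VariationalVectorForm
open Summit.QuantumFields.BalabanUV.T4Continuum.VariationalVectorEffective (unc effV)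
open Summit.QuantumFields.BalabanUV.T4Continuum.VariationalVectorAverage (continuous_QvL)
open Summit.QuantumFields.BalabanUV.T4Continuum.VariationalVectorTower (Gtr Gtr_transport QmL QvL_surjective_of_ub towerLimitRate_effV_of_pairs)

variable {d : ℕ}

/-! ## §1 The bracket defects of `vector_pair_bracket_sqrt` as real functions; monotonicity and scaling -/

section Constants

/-- the V-FED-side defect `e = 2δ√(Λ·C_P(Λ+1)) + δ²·C_P(Λ+1)` of `vector_pair_bracket_sqrt` (its conclusion's first coefficient, literally). [folklore] -/
def eV (Λ CP δ : ℝ) : ℝ := 2 * δ * Real.sqrt (Λ * (CP * (Λ + 1))) + δ ^ 2 * (CP * (Λ + 1))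

/-- the V-ONE∕V-REG-side defect `e′ = ε₁C_R(Λ+1) + 2δ′√((Λ + ε₁C_R(Λ+1))·C_P(Λ+1)) + δ′²·C_P(Λ+1)` of `vector_pair_bracket_sqrt` (its second coefficient,
literally). [folklore] -/
def ePV (Λ CP CR ε₁ δ' : ℝ) : ℝ :=
  ε₁ * CR * (Λ + 1) + 2 * δ' * Real.sqrt ((Λ + ε₁ * CR * (Λ + 1)) * (CP * (Λ + 1))) + δ' ^ 2 * (CP * (Λ + 1))

/-- `0 ≤ e`. [folklore] -/
theorem eV_nonneg {Λ CP δ : ℝ} (hΛ : 0 ≤ Λ) (hCP : 0 ≤ CP) (hδ : 0 ≤ δ) : 0 ≤ eV Λ CP δ := by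
  unfold eV; positivity

/-- `0 ≤ e′`. [folklore] -/
theorem ePV_nonneg {Λ CP CR ε₁ δ' : ℝ} (hΛ : 0 ≤ Λ) (hCP : 0 ≤ CP) (hCR : 0 ≤ CR) (hε₁ : 0 ≤ ε₁) (hδ' : 0 ≤ δ') : 0 ≤ ePV Λ CP CR ε₁ δ' := by
  unfold ePV; positivity

/-- `e` is monotone in `(Λ, C_P, δ)` on the nonnegative cone. [folklore] -/
theorem eV_mono {Λ Λ' CP CP' δ δ' : ℝ} (hΛ : 0 ≤ Λ) (hΛ' : Λ ≤ Λ') (hCP : 0 ≤ CP) (hCP' : CP ≤ CP') (hδ : 0 ≤ δ) (hδ' : δ ≤ δ') :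
    eV Λ CP δ ≤ eV Λ' CP' δ' := by
  unfold eV
  have hX : Λ * (CP * (Λ + 1)) ≤ Λ' * (CP' * (Λ' + 1)) :=
    mul_le_mul hΛ' (mul_le_mul hCP' (by linarith) (by linarith) (hCP.trans hCP')) (by positivity) (hΛ.trans hΛ')
  have hs : Real.sqrt (Λ * (CP * (Λ + 1))) ≤ Real.sqrt (Λ' * (CP' * (Λ' + 1))) := Real.sqrt_le_sqrt hX
  have hs0 : 0 ≤ Real.sqrt (Λ * (CP * (Λ + 1))) := Real.sqrt_nonneg _
  have hY : CP * (Λ + 1) ≤ CP' * (Λ' + 1) := mul_le_mul hCP' (by linarith) (by linarith) (hCP.trans hCP')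
  have hY0 : 0 ≤ CP * (Λ + 1) := by positivity
  have h1 : 2 * δ * Real.sqrt (Λ * (CP * (Λ + 1))) ≤ 2 * δ' * Real.sqrt (Λ' * (CP' * (Λ' + 1))) :=
    mul_le_mul (by linarith) hs hs0 (by linarith)
  have h2 : δ ^ 2 * (CP * (Λ + 1)) ≤ δ' ^ 2 * (CP' * (Λ' + 1)) :=
    mul_le_mul (pow_le_pow_left₀ hδ hδ' 2) hY hY0 (by positivity)
  linarith

/-- `e′` is monotone in `(Λ, C_P, C_R, ε₁, δ′)` on the nonnegative cone. [folklore] -/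
theorem ePV_mono {Λ Λ' CP CP' CR CR' ε₁ ε₁' δ δ' : ℝ} (hΛ : 0 ≤ Λ) (hΛ' : Λ ≤ Λ') (hCP : 0 ≤ CP) (hCP' : CP ≤ CP') (hCR : 0 ≤ CR)
    (hCR' : CR ≤ CR') (hε₁ : 0 ≤ ε₁) (hε₁' : ε₁ ≤ ε₁') (hδ : 0 ≤ δ) (hδ' : δ ≤ δ') :
    ePV Λ CP CR ε₁ δ ≤ ePV Λ' CP' CR' ε₁' δ' := by
  unfold ePV
  have hA : ε₁ * CR * (Λ + 1) ≤ ε₁' * CR' * (Λ' + 1) :=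
    mul_le_mul (mul_le_mul hε₁' hCR' hCR (hε₁.trans hε₁')) (by linarith) (by linarith) (mul_nonneg (hε₁.trans hε₁') (hCR.trans hCR'))
  have hA0 : 0 ≤ ε₁ * CR * (Λ + 1) := by positivity
  have hB0 : 0 ≤ ε₁' * CR' * (Λ' + 1) := mul_nonneg (mul_nonneg (hε₁.trans hε₁') (hCR.trans hCR')) (by linarith)
  have hY : CP * (Λ + 1) ≤ CP' * (Λ' + 1) := mul_le_mul hCP' (by linarith) (by linarith) (hCP.trans hCP')
  have hY0 : 0 ≤ CP * (Λ + 1) := by positivity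
  have hX : (Λ + ε₁ * CR * (Λ + 1)) * (CP * (Λ + 1)) ≤ (Λ' + ε₁' * CR' * (Λ' + 1)) * (CP' * (Λ' + 1)) :=
    mul_le_mul (by linarith) hY hY0 (by linarith)
  have hs : Real.sqrt ((Λ + ε₁ * CR * (Λ + 1)) * (CP * (Λ + 1))) ≤ Real.sqrt ((Λ' + ε₁' * CR' * (Λ' + 1)) * (CP' * (Λ' + 1))) :=
    Real.sqrt_le_sqrt hX
  have hs0 : 0 ≤ Real.sqrt ((Λ + ε₁ * CR * (Λ + 1)) * (CP * (Λ + 1))) := Real.sqrt_nonneg _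
  have h1 : 2 * δ * Real.sqrt ((Λ + ε₁ * CR * (Λ + 1)) * (CP * (Λ + 1)))
      ≤ 2 * δ' * Real.sqrt ((Λ' + ε₁' * CR' * (Λ' + 1)) * (CP' * (Λ' + 1))) :=
    mul_le_mul (by linarith) hs hs0 (by linarith)
  have h2 : δ ^ 2 * (CP * (Λ + 1)) ≤ δ' ^ 2 * (CP' * (Λ' + 1)) :=
    mul_le_mul (pow_le_pow_left₀ hδ hδ' 2) hY hY0 (by positivity)
  linarith

/-- SCALING of `e`: for `t ∈ [0, 1]`, `e(Λ, C_P, c·t) ≤ e(Λ, C_P, c)·t` (linear term exact, quadratic term by `t² ≤ t`). [folklore] -/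
theorem eV_scale {Λ CP c t : ℝ} (hΛ : 0 ≤ Λ) (hCP : 0 ≤ CP) (ht : 0 ≤ t) (ht1 : t ≤ 1) :
    eV Λ CP (c * t) ≤ eV Λ CP c * t := by
  unfold eV
  have hs0 : 0 ≤ Real.sqrt (Λ * (CP * (Λ + 1))) := Real.sqrt_nonneg _
  have hY0 : 0 ≤ CP * (Λ + 1) := by positivity
  have htt : t ^ 2 ≤ t := by nlinarith
  have h2 : (c * t) ^ 2 * (CP * (Λ + 1)) ≤ c ^ 2 * (CP * (Λ + 1)) * t := by
    rw [mul_pow]; nlinarith [mul_nonneg (mul_nonneg (sq_nonneg c) hY0) (sub_nonneg.mpr htt)]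
  nlinarith

/-- SCALING of `e′`: for `t ∈ [0, 1]`, `e′(Λ, C_P, C_R, c_ε·t, c·t) ≤ e′(Λ, C_P, C_R, c_ε, c)·t`. [folklore] -/
theorem ePV_scale {Λ CP CR cε c t : ℝ} (hΛ : 0 ≤ Λ) (hCP : 0 ≤ CP) (hCR : 0 ≤ CR) (hcε : 0 ≤ cε) (hc : 0 ≤ c) (ht : 0 ≤ t) (ht1 : t ≤ 1) :
    ePV Λ CP CR (cε * t) (c * t) ≤ ePV Λ CP CR cε c * t := by
  unfold ePV
  have hY0 : 0 ≤ CP * (Λ + 1) := by positivity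
  have hεt : cε * t ≤ cε := mul_le_of_le_one_right hcε ht1
  have hX : (Λ + cε * t * CR * (Λ + 1)) * (CP * (Λ + 1)) ≤ (Λ + cε * CR * (Λ + 1)) * (CP * (Λ + 1)) := by
    refine mul_le_mul_of_nonneg_right ?_ hY0
    have : cε * t * CR * (Λ + 1) ≤ cε * CR * (Λ + 1) :=
      mul_le_mul_of_nonneg_right (mul_le_mul_of_nonneg_right hεt hCR) (by linarith)
    linarith
  have hs : Real.sqrt ((Λ + cε * t * CR * (Λ + 1)) * (CP * (Λ + 1))) ≤ Real.sqrt ((Λ + cε * CR * (Λ + 1)) * (CP * (Λ + 1))) :=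
    Real.sqrt_le_sqrt hX
  have hs0 : 0 ≤ Real.sqrt ((Λ + cε * t * CR * (Λ + 1)) * (CP * (Λ + 1))) := Real.sqrt_nonneg _
  have hS0 : 0 ≤ Real.sqrt ((Λ + cε * CR * (Λ + 1)) * (CP * (Λ + 1))) := Real.sqrt_nonneg _
  have h1 : 2 * (c * t) * Real.sqrt ((Λ + cε * t * CR * (Λ + 1)) * (CP * (Λ + 1)))
      ≤ 2 * c * Real.sqrt ((Λ + cε * CR * (Λ + 1)) * (CP * (Λ + 1))) * t := by
    have := mul_le_mul_of_nonneg_left hs (by positivity : 0 ≤ 2 * (c * t))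
    nlinarith
  have htt : t ^ 2 ≤ t := by nlinarith
  have h2 : (c * t) ^ 2 * (CP * (Λ + 1)) ≤ c ^ 2 * (CP * (Λ + 1)) * t := by
    rw [mul_pow]; nlinarith [mul_nonneg (mul_nonneg (sq_nonneg c) hY0) (sub_nonneg.mpr htt)]
  have h0 : cε * t * CR * (Λ + 1) = cε * CR * (Λ + 1) * t := by ring
  nlinarith

/-- **PER-LEVEL RATE OF `e`**: uniform bounds `Λ_k ≤ Λ⋆`, `C_P,k ≤ C_P⋆` and decay `δ_k ≤ c_δ·θ^k` (`0 ≤ θ ≤ 1`, everything nonnegative) ⟹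
`e(Λ_k, C_P,k, δ_k) ≤ eV Λ⋆ C_P⋆ c_δ · θ^k`. [folklore] -/
theorem eV_level_le {Λ Λs CP CPs δ cδ θ : ℝ} (k : ℕ) (hΛ : 0 ≤ Λ) (hΛs : Λ ≤ Λs) (hCP : 0 ≤ CP) (hCPs : CP ≤ CPs) (hδ : 0 ≤ δ)
    (hθ : 0 ≤ θ) (hθ1 : θ ≤ 1) (hδθ : δ ≤ cδ * θ ^ k) : eV Λ CP δ ≤ eV Λs CPs cδ * θ ^ k :=
  (eV_mono hΛ hΛs hCP hCPs hδ hδθ).trans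
    (eV_scale (hΛ.trans hΛs) (hCP.trans hCPs) (pow_nonneg hθ k) (pow_le_one₀ hθ hθ1))

/-- **PER-LEVEL RATE OF `e′`**: uniform bounds `Λ_k ≤ Λ⋆`, `C_P,k ≤ C_P⋆`, `C_R,k ≤ C_R⋆` and decay `ε₁,k ≤ c_ε·θ^k`, `δ′_k ≤ c_δ′·θ^k` ⟹
`e′(Λ_k, C_P,k, C_R,k, ε₁,k, δ′_k) ≤ ePV Λ⋆ C_P⋆ C_R⋆ c_ε c_δ′ · θ^k`. [folklore] -/
theorem ePV_level_le {Λ Λs CP CPs CR CRs ε₁ cε δ' cδ' θ : ℝ} (k : ℕ) (hΛ : 0 ≤ Λ) (hΛs : Λ ≤ Λs) (hCP : 0 ≤ CP) (hCPs : CP ≤ CPs)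
    (hCR : 0 ≤ CR) (hCRs : CR ≤ CRs) (hε₁ : 0 ≤ ε₁) (hcε : 0 ≤ cε) (hδ' : 0 ≤ δ') (hcδ' : 0 ≤ cδ') (hθ : 0 ≤ θ) (hθ1 : θ ≤ 1)
    (hεθ : ε₁ ≤ cε * θ ^ k) (hδ'θ : δ' ≤ cδ' * θ ^ k) : ePV Λ CP CR ε₁ δ' ≤ ePV Λs CPs CRs cε cδ' * θ ^ k :=
  (ePV_mono hΛ hΛs hCP hCPs hCR hCRs hε₁ hεθ hδ' hδ'θ).trans
    (ePV_scale (hΛ.trans hΛs) (hCP.trans hCPs) (hCR.trans hCRs) hcε hcδ' (pow_nonneg hθ k) (pow_le_one₀ hθ hθ1))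

end Constants

/-! ## §2 The (GF0) ∕ continuity binders from the matrix form of the functional and from the COMP identity `G_{k+1} = Gtr G′_k` -/

section Functional

/-- uncurrying is continuous. [folklore] -/
theorem continuous_unc {α β : Type*} : Continuous (fun W : α → β → ℂ => unc W) :=
  continuous_pi fun p => (continuous_apply p.2).comp (continuous_apply p.1)

/-- a Hermitian-form value `w ↦ re⟨w, K w⟩` is continuous. [folklore] -/
theorem continuous_qform {ι : Type*} [Fintype ι] (K : Matrix ι ι ℂ) : Continuous fun w : ι → ℂ => qform K w := by
  unfold qform
  exact Complex.continuous_re.comp (continuous_star.dotProduct (continuous_const.matrix_mulVec continuous_id))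

variable (n L : ℕ) [NeZero n] (M : Fin d → ℕ) [hM : ∀ μ, NeZero (M μ)]

/-- (GF0) from the matrix form: `G = qform Gm ∘ unc` with `Gm` PSD ⟹ `0 ≤ G`. [folklore] -/
theorem nonneg_of_qform {Gm : Matrix (Tor (fine n M) × Fin d) (Tor (fine n M) × Fin d) ℂ} (hGm : Gm.PosSemidef)
    {G : (Tor (fine n M) → Fin d → ℂ) → ℝ} (hG : ∀ W, G W = qform Gm (unc W)) (W : Tor (fine n M) → Fin d → ℂ) : 0 ≤ G W := by
  rw [hG]; exact qform_nonneg_of_posSemidef hGm _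

/-- continuity from the matrix form. [folklore] -/
theorem continuous_of_qform {Gm : Matrix (Tor (fine n M) × Fin d) (Tor (fine n M) × Fin d) ℂ}
    {G : (Tor (fine n M) → Fin d → ℂ) → ℝ} (hG : ∀ W, G W = qform Gm (unc W)) : Continuous G := by
  have h : G = fun W => qform Gm (unc W) := funext hG
  rw [h]
  exact (continuous_qform Gm).comp continuous_unc

variable {E : Type*} [NormedAddCommGroup E]

omit [NeZero n] hM [NormedAddCommGroup E] in
/-- the fine functional is read off the transported one: `G = Gtr G′ ⟹ G′ W′ = G (W′ ∘ sites)`. [folklore] -/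
theorem eq_of_Gtr {G : (Tor (fine (n * L) M) → Fin d → E) → ℝ} {G' : (Tor (fine L (fine n M)) → Fin d → E) → ℝ} (hGtr : G = Gtr n L M G')
    (W' : Tor (fine L (fine n M)) → Fin d → E) : G' W' = G (W' ∘ sites n L M) := by
  rw [hGtr, Gtr_transport]

omit [NeZero n] hM [NormedAddCommGroup E] in
/-- (GF0) one step up: `G = Gtr G′`, `0 ≤ G ⟹ 0 ≤ G′`. [folklore] -/
theorem nonneg_of_Gtr {G : (Tor (fine (n * L) M) → Fin d → E) → ℝ} {G' : (Tor (fine L (fine n M)) → Fin d → E) → ℝ} (hGtr : G = Gtr n L M G')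
    (hG0 : ∀ W, 0 ≤ G W) (W' : Tor (fine L (fine n M)) → Fin d → E) : 0 ≤ G' W' := by
  rw [eq_of_Gtr n L M hGtr]; exact hG0 _

omit [NeZero n] hM in
/-- continuity one step up: `G = Gtr G′`, `G` continuous ⟹ `G′` continuous. [folklore] -/
theorem continuous_of_Gtr {G : (Tor (fine (n * L) M) → Fin d → E) → ℝ} {G' : (Tor (fine L (fine n M)) → Fin d → E) → ℝ}
    (hGtr : G = Gtr n L M G') (hGc : Continuous G) : Continuous G' := by
  have h : G' = fun W' => G (W' ∘ sites n L M) := funext (eq_of_Gtr n L M hGtr)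
  rw [h]
  exact hGc.comp (continuous_pi fun x => continuous_apply (sites n L M x))

end Functional

/-! ## §3 The brackets from the leaves (one level) and THE VECTOR END MODULO THE LEAVES (the tower) -/

section OneLevel

variable {E : Type*} [NormedAddCommGroup E] [InnerProductSpace ℂ E]
variable (n L : ℕ) [NeZero n] [NeZero L] (M : Fin d → ℕ) [hM : ∀ μ, NeZero (M μ)]

/-- **THE TWO BRACKETS FROM THE FIVE DISPLAYED VECTOR LEAVES, LINE-INDEXED CARRIERS** (one level; `vector_pair_bracket_sqrt` at `Qk := QvL n M T`,
`Q₁ := QvL L (fine n M) T′`, continuity of both from `continuous_QvL`): V-UB (`hUBc`, `hUBf`, `Λ`), V-P (`hPc`, `hPf`, `C_P`), V-FED (`hFED`, `δ`), V-ONE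
(`hONE`, `ε₁`, `δ′`, `ρ`), V-REG (`hREG`, `C_R`) + `Q₁` onto + (GF0)∕continuity of `G`, `G′` ⟹ the brackets with defects `eV Λ C_P δ`, `ePV Λ C_P C_R ε₁ δ′`.
[folklore] -/
theorem vector_pair_brackets_of_leaves [FiniteDimensional ℂ E]
    {R : Tor (fine n M) → Fin d → (E →L[ℂ] E)} {R' : Tor (fine L (fine n M)) → Fin d → (E →L[ℂ] E)}
    {G : (Tor (fine n M) → Fin d → E) → ℝ} {G' : (Tor (fine L (fine n M)) → Fin d → E) → ℝ}
    {T : Tor M → (Fin d → Fin n) → Fin n → Fin d → (E →L[ℂ] E)} {T' : Tor (fine n M) → (Fin d → Fin L) → Fin L → Fin d → (E →L[ℂ] E)}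
    (hsurj₁ : Function.Surjective (QvL L (fine n M) T'))
    (hG0 : ∀ W, 0 ≤ G W) (hGc : Continuous G) (hG0' : ∀ W', 0 ≤ G' W') (hGc' : Continuous G')
    {Λ CP CR δ ε₁ δ' : ℝ} (hΛ : 0 ≤ Λ) (hCP : 0 ≤ CP) (hCR : 0 ≤ CR) (hδ : 0 ≤ δ) (hε₁ : 0 ≤ ε₁) (hδ' : 0 ≤ δ')
    {ρ : (Tor (fine n M) → Fin d → E) → ℝ} (hρ0 : ∀ W, 0 ≤ ρ W)
    (hUBc : ∀ φ : Tor M → Fin d → E, ∃ W, QvL n M T W = φ ∧ ScV n M R G W ≤ Λ * nsqV M φ)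
    (hUBf : ∀ φ : Tor M → Fin d → E, ∃ W', QvL n M T (QvL L (fine n M) T' W') = φ ∧ SfV n L M R' G' W' ≤ Λ * nsqV M φ)
    (hPc : ∀ W, qWV n M W ≤ CP * (ScV n M R G W + nsqV M (QvL n M T W)))
    (hPf : ∀ W', qVV n L M W' ≤ CP * (SfV n L M R' G' W' + nsqV M (QvL n M T (QvL L (fine n M) T' W'))))
    (hFED : ∀ W', ScV n M R G (QvL L (fine n M) T' W') ≤ (Real.sqrt (SfV n L M R' G' W') + δ * Real.sqrt (qVV n L M W')) ^ 2)
    (hONE : ∀ W, blockSpin (QvL L (fine n M) T') (SfV n L M R' G') W ≤ (Real.sqrt (ScV n M R G W + ε₁ * ρ W) + δ' * Real.sqrt (qWV n M W)) ^ 2)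
    (hREG : ∀ (φ : Tor M → Fin d → E) W, QvL n M T W = φ → (∀ W₂, QvL n M T W₂ = φ → ScV n M R G W ≤ ScV n M R G W₂) →
      ρ W ≤ CR * (ScV n M R G W + nsqV M φ))
    (φ : Tor M → Fin d → E) :
    blockSpin (QvL n M T) (ScV n M R G) φ ≤ blockSpin (QvL n M T ∘ QvL L (fine n M) T') (SfV n L M R' G') φ + eV Λ CP δ * nsqV M φ ∧
      blockSpin (QvL n M T ∘ QvL L (fine n M) T') (SfV n L M R' G') φ ≤ blockSpin (QvL n M T) (ScV n M R G) φ + ePV Λ CP CR ε₁ δ' * nsqV M φ :=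
  vector_pair_bracket_sqrt n L M (continuous_QvL n M T) (continuous_QvL L (fine n M) T') hsurj₁ hG0 hGc hG0' hGc' hΛ hCP hCR hδ hε₁ hδ' hρ0
    hUBc hUBf hPc hPf hFED hONE hREG φ

end OneLevel

section Tower

variable (L : ℕ) [NeZero L] (M : Fin d → ℕ) [hM : ∀ μ, NeZero (M μ)]
variable (R : (k : ℕ) → Tor (fine (L ^ k) M) → Fin d → (ℂ →L[ℂ] ℂ))
variable (R' : (k : ℕ) → Tor (fine L (fine (L ^ k) M)) → Fin d → (ℂ →L[ℂ] ℂ))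
variable (Gm : (k : ℕ) → Matrix (Tor (fine (L ^ k) M) × Fin d) (Tor (fine (L ^ k) M) × Fin d) ℂ)
variable (G : (k : ℕ) → (Tor (fine (L ^ k) M) → Fin d → ℂ) → ℝ)
variable (G' : (k : ℕ) → (Tor (fine L (fine (L ^ k) M)) → Fin d → ℂ) → ℝ)
variable (T : (k : ℕ) → Tor M → (Fin d → Fin (L ^ k)) → Fin (L ^ k) → Fin d → (ℂ →L[ℂ] ℂ))
variable (T' : (k : ℕ) → Tor (fine (L ^ k) M) → (Fin d → Fin L) → Fin L → Fin d → (ℂ →L[ℂ] ℂ))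

/-- **THE VECTOR END OF ROAD P2 MODULO THE LEAVES, ON THE `QvL` CARRIERS.**  Tower data along `n_k = L^k`: bond transports `R k`, one-step bond transports
`R′ k`, PSD matrices `Gm k` with functionals `G k = qform (Gm k) ∘ unc`, one-step functionals `G′ k`, line transports `T k`, one-step line transports
`T′ k`, tied by the COMP DATA identities `T (k+1) = compL (T k) (T′ k)`, `R (k+1) = Rtrv (R′ k)`, `G (k+1) = Gtr (G′ k)`; `QvL L _ (T′ k)` onto (one-step
V-UB-L); the five vector leaves DISPLAYED per level in `vector_pair_bracket_sqrt`'s letters — V-UB (`hUBc k`, `hUBf k`, constants `Λ k ≤ Λ⋆`), V-P (`hPc k`,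
`hPf k`, `C_P k ≤ C_P⋆`), V-FED (`hFED k`, `δ k ≤ c_δ·θ^k`), V-ONE (`hONE k`, `ε₁ k ≤ c_ε·θ^k`, `δ′ k ≤ c_δ′·θ^k`, functional `ρV k ≥ 0`), V-REG (`hREG k`,
`C_R k ≤ C_R⋆`) — with `0 ≤ θ < 1`, `0 < a`.  THEN the vector effective operators `X^V_k = effV (L^k) M (R k) (Gm k) (QmL (L^k) M (T k)) a` on the unit
index `Tor M × Fin d` CONVERGE at rate `θ`: `TowerLimitRate (fun _ ↦ 1) 1 X^V (eV Λ⋆ C_P⋆ c_δ + ePV Λ⋆ C_P⋆ C_R⋆ c_ε c_δ′) θ`, i.e.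
`‖X^V_k − X^V_∞‖ ≤ C·θ^k∕(1 − θ)`.  Every leaf DISPLAYED, none discharged; V-COMP discharged (p218283 ∕ p218948); (GF0), continuity and `Qk`-surjectivity
DERIVED (§2, `QvL_surjective_of_ub`).  Nothing of NE3. [folklore] -/
theorem towerLimitRate_effV_of_leaves (hGm : ∀ k, (Gm k).PosSemidef) (hG : ∀ k W, G k W = qform (Gm k) (unc W))
    (hTcomp : ∀ k, T (k + 1) = compL (L ^ k) L M (T k) (T' k)) (hRtr : ∀ k, R (k + 1) = Rtrv (L ^ k) L M (R' k))
    (hGtr : ∀ k, G (k + 1) = Gtr (L ^ k) L M (G' k))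
    (hsurj₁ : ∀ k, Function.Surjective (QvL L (fine (L ^ k) M) (T' k)))
    {a : ℝ} (ha : 0 < a)
    (Λ CP CR δ ε₁ δ' : ℕ → ℝ) {Λs CPs CRs cδ cε cδ' θ : ℝ}
    (hΛ : ∀ k, 0 ≤ Λ k) (hΛs : ∀ k, Λ k ≤ Λs) (hCP : ∀ k, 0 ≤ CP k) (hCPs : ∀ k, CP k ≤ CPs) (hCR : ∀ k, 0 ≤ CR k) (hCRs : ∀ k, CR k ≤ CRs)
    (hδ : ∀ k, 0 ≤ δ k) (hε₁ : ∀ k, 0 ≤ ε₁ k) (hδ' : ∀ k, 0 ≤ δ' k) (hθ : 0 ≤ θ) (hθ1 : θ < 1)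
    (hδθ : ∀ k, δ k ≤ cδ * θ ^ k) (hεθ : ∀ k, ε₁ k ≤ cε * θ ^ k) (hδ'θ : ∀ k, δ' k ≤ cδ' * θ ^ k)
    {ρV : (k : ℕ) → (Tor (fine (L ^ k) M) → Fin d → ℂ) → ℝ} (hρ0 : ∀ k W, 0 ≤ ρV k W)
    -- leaf V-UB at both levels
    (hUBc : ∀ k (φ : Tor M → Fin d → ℂ), ∃ W, QvL (L ^ k) M (T k) W = φ ∧ ScV (L ^ k) M (R k) (G k) W ≤ Λ k * nsqV M φ)
    (hUBf : ∀ k (φ : Tor M → Fin d → ℂ), ∃ W', QvL (L ^ k) M (T k) (QvL L (fine (L ^ k) M) (T' k) W') = φ ∧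
      SfV (L ^ k) L M (R' k) (G' k) W' ≤ Λ k * nsqV M φ)
    -- leaf V-P at both levels
    (hPc : ∀ k W, qWV (L ^ k) M W ≤ CP k * (ScV (L ^ k) M (R k) (G k) W + nsqV M (QvL (L ^ k) M (T k) W)))
    (hPf : ∀ k W', qVV (L ^ k) L M W' ≤ CP k * (SfV (L ^ k) L M (R' k) (G' k) W' + nsqV M (QvL (L ^ k) M (T k) (QvL L (fine (L ^ k) M) (T' k) W'))))
    -- leaf V-FED
    (hFED : ∀ k W', ScV (L ^ k) M (R k) (G k) (QvL L (fine (L ^ k) M) (T' k) W')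
      ≤ (Real.sqrt (SfV (L ^ k) L M (R' k) (G' k) W') + δ k * Real.sqrt (qVV (L ^ k) L M W')) ^ 2)
    -- leaf V-ONE (square-root shape) and leaf V-REG
    (hONE : ∀ k W, blockSpin (QvL L (fine (L ^ k) M) (T' k)) (SfV (L ^ k) L M (R' k) (G' k)) W
      ≤ (Real.sqrt (ScV (L ^ k) M (R k) (G k) W + ε₁ k * ρV k W) + δ' k * Real.sqrt (qWV (L ^ k) M W)) ^ 2)
    (hREG : ∀ k (φ : Tor M → Fin d → ℂ) W, QvL (L ^ k) M (T k) W = φ →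
      (∀ W₂, QvL (L ^ k) M (T k) W₂ = φ → ScV (L ^ k) M (R k) (G k) W ≤ ScV (L ^ k) M (R k) (G k) W₂) →
      ρV k W ≤ CR k * (ScV (L ^ k) M (R k) (G k) W + nsqV M φ)) :
    TowerLimitRate (ι := fun _ => Tor M × Fin d) (fun _ => (1 : Matrix (Tor M × Fin d) (Tor M × Fin d) ℂ)) 1
      (fun k => effV (L ^ k) M (R k) (Gm k) (QmL (L ^ k) M (T k)) a) (eV Λs CPs cδ + ePV Λs CPs CRs cε cδ') θ := by
  -- (GF0) and continuity at every level, from the matrix form and one step up through `Gtr`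
  have hG0 : ∀ k W, 0 ≤ G k W := fun k => nonneg_of_qform (L ^ k) M (hGm k) (hG k)
  have hGc : ∀ k, Continuous (G k) := fun k => continuous_of_qform (L ^ k) M (hG k)
  have hG0' : ∀ k W', 0 ≤ G' k W' := fun k => nonneg_of_Gtr (L ^ k) L M (hGtr k) (hG0 (k + 1))
  have hGc' : ∀ k, Continuous (G' k) := fun k => continuous_of_Gtr (L ^ k) L M (hGtr k) (hGc (k + 1))
  -- the starred constants are nonnegative (level 0)
  have hθ1' : θ ≤ 1 := hθ1.le
  have hΛs0 : 0 ≤ Λs := (hΛ 0).trans (hΛs 0)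
  have hCPs0 : 0 ≤ CPs := (hCP 0).trans (hCPs 0)
  have hCRs0 : 0 ≤ CRs := (hCR 0).trans (hCRs 0)
  have hcδ : 0 ≤ cδ := by have := (hδ 0).trans (hδθ 0); simpa using this
  have hcε : 0 ≤ cε := by have := (hε₁ 0).trans (hεθ 0); simpa using this
  have hcδ' : 0 ≤ cδ' := by have := (hδ' 0).trans (hδ'θ 0); simpa using this
  have hC : 0 ≤ eV Λs CPs cδ + ePV Λs CPs CRs cε cδ' := add_nonneg (eV_nonneg hΛs0 hCPs0 hcδ) (ePV_nonneg hΛs0 hCPs0 hCRs0 hcε hcδ')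
  -- per-level rates of the two defects
  have he : ∀ k, eV (Λ k) (CP k) (δ k) ≤ (eV Λs CPs cδ + ePV Λs CPs CRs cε cδ') * θ ^ k := fun k => by
    have h1 := eV_level_le k (hΛ k) (hΛs k) (hCP k) (hCPs k) (hδ k) hθ hθ1' (hδθ k)
    have h2 : 0 ≤ ePV Λs CPs CRs cε cδ' * θ ^ k := mul_nonneg (ePV_nonneg hΛs0 hCPs0 hCRs0 hcε hcδ') (pow_nonneg hθ k)
    linarith [add_mul (eV Λs CPs cδ) (ePV Λs CPs CRs cε cδ') (θ ^ k)]
  have he' : ∀ k, ePV (Λ k) (CP k) (CR k) (ε₁ k) (δ' k) ≤ (eV Λs CPs cδ + ePV Λs CPs CRs cε cδ') * θ ^ k := fun k => by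
    have h1 := ePV_level_le k (hΛ k) (hΛs k) (hCP k) (hCPs k) (hCR k) (hCRs k) (hε₁ k) hcε (hδ' k) hcδ' hθ hθ1' (hεθ k) (hδ'θ k)
    have h2 : 0 ≤ eV Λs CPs cδ * θ ^ k := mul_nonneg (eV_nonneg hΛs0 hCPs0 hcδ) (pow_nonneg hθ k)
    linarith [add_mul (eV Λs CPs cδ) (ePV Λs CPs CRs cε cδ') (θ ^ k)]
  -- the brackets from the leaves, level by level, fed to the pair-to-rate currency
  exact towerLimitRate_effV_of_pairs L M R R' Gm G G' T T' hGm hG (fun k => QvL_surjective_of_ub (L ^ k) M (hUBc k)) hPc hTcomp hRtr hGtr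
    ha hC hθ hθ1 (fun k => eV (Λ k) (CP k) (δ k)) (fun k => ePV (Λ k) (CP k) (CR k) (ε₁ k) (δ' k)) he he'
    fun k φ => vector_pair_brackets_of_leaves (L ^ k) L M (hsurj₁ k) (hG0 k) (hGc k) (hG0' k) (hGc' k) (hΛ k) (hCP k) (hCR k) (hδ k) (hε₁ k)
      (hδ' k) (hρ0 k) (hUBc k) (hUBf k) (hPc k) (hPf k) (hFED k) (hONE k) (hREG k) φ

end Tower

end Summit.QuantumFields.BalabanUV.T4Continuum.VariationalVectorEndOfLeaves

end
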